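import Mathlib
import HarnessLib
import Summits.Ventures.LatticeQCDFlow.Scaling.HolonomyNonDeterminationAnyGroup

/-!
# LatticeQCDFlow / Scaling — non-determination below `(d−1)(L^d − 1)` plaquettes for EVERY nontrivial
# gauge group (finite groups, `ℤ_N`, elements of finite order): certificates modulo a prime

HONEST FRAMING: exact (Metropolis-corrected) sampling algorithms for lattice gauge theory;
figures of merit are autocorrelation/cost numbers at stated couplings and volumes; no
continuum-physics claim.

Venture `LatticeQCDFlow` (cell pub-lqcd), topic `Scaling`, FANOUT row 30 (lean-1, GEN-28) — OUR WORK on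
THEORY-2.md §4 row C5 (gen25 Q2, the converse for ALL groups).  `Scaling/AbelianHolonomyNonDetermination` and
`Scaling/HolonomyNonDeterminationAnyGroup` proved: if `#B < (d−1)(L^d − 1)` and the group `G` has, for every
`n ≠ 0`, an element with `g^n ≠ 1` (`U(1)`, `ℤ`, `SU(N)`, …), then some plaquette holonomy is not determined by
the holonomies around `B` — an INTEGER certificate `θ` (`⟨θ, σ∂p⟩ = 0` on `B`, `⟨θ, σ∂p'⟩ = n ≠ 0`) and the
configuration `g^θ`.  That hypothesis FAILS for every finite group (`ℤ_N` gauge theory, finite subgroups of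
`SU(N)`): `n` may be a multiple of the exponent.  Here the gap is closed — the conclusion holds for EVERY group
with a non-identity element — by working modulo a prime:

* §1 over ANY FIELD `K`: the signed boundaries of a ranked structure are `K`-independent (the top-link pivots
  of `TorusSignedBoundary` are `±1` over every ring), so (**`le_finrank_span_signedBoundary`**) the signed
  boundaries of all plaquettes span a `K`-space of dimension `≥ (d−1)(L^d − 1)` (the Morse structure), and
  (**`exists_signedBoundary_notMem_span`**) whenever `#B < (d−1)(L^d − 1)` some `σ∂p'` lies outside the
  `K`-span of `{σ∂p : p ∈ B}`;
* §2 **`exists_certificate_mod_prime`** — `K = ℤ/ℓ`, `ℓ` prime: a separating functional, its coordinates lifted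
  to `ℤ`, gives `θ : links → ℤ` with `ℓ ∣ ⟨θ, σ∂p⟩` for every `p ∈ B` and `ℓ ∤ ⟨θ, σ∂p'⟩`;
* §3 **`exists_plaquetteHolonomy_not_determined_of_prime_order`** — for `g` of prime order `ℓ` in ANY group the
  configuration `g^θ` has holonomy `g^{⟨θ,σ∂p⟩} = 1` around every `p ∈ B` and `≠ 1` around `p'`;
  **`exists_plaquetteHolonomy_not_determined_of_ne_one`** — for ANY `g ≠ 1`: an element of finite order
  `N > 1` has the power `g^{N/ℓ}` of prime order `ℓ = minFac N`, an element of infinite order is the case of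
  `HolonomyNonDeterminationAnyGroup`; **`exists_plaquetteHolonomy_not_determined_of_nontrivial`** —
  NON-DETERMINATION BELOW `(d−1)(L^d − 1)` PLAQUETTES FOR EVERY NONTRIVIAL GAUGE GROUP; the instance
  **`…_zmod`** (`ℤ_N` gauge theory, `G = Multiplicative (ℤ/N)`, `N > 1`);
* §4 **`covered_determine_imp_card_eq_of_nontrivial`** — a ranked structure whose covered holonomies determine
  every plaquette holonomy of every `G`-field, `G` ANY nontrivial group, is full (`#B = (d−1)(L^d − 1)`, i.e.
  optimal); **`covered_determine_iff_card_eq_of_comm`** — for every nontrivial COMMUTATIVE `G` (finite or not)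
  and every ranked `B`: determination ⇔ `#B = (d−1)(L^d − 1)` (`⇐` is `AbelianHolonomyDetermination`), so the
  equivalence «determination ⇔ full ⇔ optimal» of `AbelianHolonomyNonDetermination` now covers `ℤ_N`.

No `def`, no `sorry`, nothing cited as a fact beyond the tree.
-/

namespace Summit.Ventures.LatticeQCDFlow.Theory2.Autoregressive

open Finset
open Literature.MathematicalPhysics.QuantumFieldTheory

variable {d L : ℕ} [NeZero L]

/-! ## §1 Over any field: a plaquette boundary outside the span of fewer than `(d−1)(L^d−1)` boundaries -/

omit [NeZero L] in
/-- **The signed boundaries of a ranked structure are independent over every field `K`** (top-link pivots are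
`±1`). [ours] -/
theorem linearIndependent_signedBoundary_of_ranked (K : Type*) [Field K] (hL : 2 ≤ L)
    (B : Finset (Plaquette d L)) (t : Plaquette d L → Edge d L)
    (ht : ∀ p ∈ B, t p ∈ ({(p.1, p.2.1.1), (p.1.shift p.2.1.1, p.2.1.2),
        (p.1.shift p.2.1.2, p.2.1.1), (p.1, p.2.1.2)} : Finset (Edge d L)))
    (rank : Plaquette d L → ℕ)
    (hrank : ∀ p ∈ B, ∀ p' ∈ B, p ≠ p' → t p ∈ ({(p'.1, p'.2.1.1), (p'.1.shift p'.2.1.1, p'.2.1.2),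
        (p'.1.shift p'.2.1.2, p'.2.1.1), (p'.1, p'.2.1.2)} : Finset (Edge d L)) → rank p < rank p') :
    LinearIndependent K (fun p : B =>
      (Pi.single ((p : Plaquette d L).1, (p : Plaquette d L).2.1.1) 1 +
        Pi.single ((p : Plaquette d L).1.shift (p : Plaquette d L).2.1.1, (p : Plaquette d L).2.1.2) 1 -
        Pi.single ((p : Plaquette d L).1.shift (p : Plaquette d L).2.1.2, (p : Plaquette d L).2.1.1) 1 -
        Pi.single ((p : Plaquette d L).1, (p : Plaquette d L).2.1.2) 1 : Edge d L → K)) := by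
  classical
  rw [Fintype.linearIndependent_iff]
  intro g hg p
  have key := eq_zero_of_sum_smul_signedBoundary_apply_top (R := K) hL B t ht rank hrank
    (fun q => if h : q ∈ B then g ⟨q, h⟩ else 0) ?_
  · have h : (if h : (p : Plaquette d L) ∈ B then g ⟨p, h⟩ else 0) = 0 := key p p.2
    rwa [dif_pos p.2] at h
  · intro q hq
    have hsum : ∑ p' ∈ B, (fun q : Plaquette d L => if h : q ∈ B then g ⟨q, h⟩ else 0) p' •
        (Pi.single (p'.1, p'.2.1.1) 1 + Pi.single (p'.1.shift p'.2.1.1, p'.2.1.2) 1 -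
        Pi.single (p'.1.shift p'.2.1.2, p'.2.1.1) 1 - Pi.single (p'.1, p'.2.1.2) 1 : Edge d L → K) =
        ∑ i : B, g i • (Pi.single ((i : Plaquette d L).1, (i : Plaquette d L).2.1.1) 1 +
        Pi.single ((i : Plaquette d L).1.shift (i : Plaquette d L).2.1.1, (i : Plaquette d L).2.1.2) 1 -
        Pi.single ((i : Plaquette d L).1.shift (i : Plaquette d L).2.1.2, (i : Plaquette d L).2.1.1) 1 -
        Pi.single ((i : Plaquette d L).1, (i : Plaquette d L).2.1.2) 1 : Edge d L → K) := by
      rw [← Finset.sum_coe_sort B]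
      refine Finset.sum_congr rfl fun i _ => ?_
      dsimp only
      rw [dif_pos i.2]
    rw [hsum, hg, Pi.zero_apply]

/-- **Over every field the signed boundaries of all plaquettes span a space of dimension at least
`(d−1)(L^d − 1)`** (`L ≥ 2`): the boundaries of the Morse structure
(`TorusRankedMorseCount.exists_ranked_card_compl_eq`) are that many independent vectors. [ours] -/
theorem le_finrank_span_signedBoundary (K : Type*) [Field K] (hL : 2 ≤ L) :
    (d - 1) * (L ^ d - 1) ≤ Module.finrank K (Submodule.span K (Set.range fun p : Plaquette d L =>
      (Pi.single (p.1, p.2.1.1) 1 + Pi.single (p.1.shift p.2.1.1, p.2.1.2) 1 -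
        Pi.single (p.1.shift p.2.1.2, p.2.1.1) 1 - Pi.single (p.1, p.2.1.2) 1 : Edge d L → K))) := by
  classical
  obtain ⟨M, tM, rM, -, htM, hrM, -, hcardM⟩ := exists_ranked_card_compl_eq (d := d) hL
  have hliM := linearIndependent_signedBoundary_of_ranked K hL M tM htM rM hrM
  have h1 : Module.finrank K (Submodule.span K (Set.range fun p : M =>
      (Pi.single ((p : Plaquette d L).1, (p : Plaquette d L).2.1.1) 1 +
        Pi.single ((p : Plaquette d L).1.shift (p : Plaquette d L).2.1.1, (p : Plaquette d L).2.1.2) 1 -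
        Pi.single ((p : Plaquette d L).1.shift (p : Plaquette d L).2.1.2, (p : Plaquette d L).2.1.1) 1 -
        Pi.single ((p : Plaquette d L).1, (p : Plaquette d L).2.1.2) 1 : Edge d L → K))) = M.card := by
    rw [finrank_span_eq_card hliM, Fintype.card_coe]
  have hle : Submodule.span K (Set.range fun p : M =>
      (Pi.single ((p : Plaquette d L).1, (p : Plaquette d L).2.1.1) 1 +
        Pi.single ((p : Plaquette d L).1.shift (p : Plaquette d L).2.1.1, (p : Plaquette d L).2.1.2) 1 -
        Pi.single ((p : Plaquette d L).1.shift (p : Plaquette d L).2.1.2, (p : Plaquette d L).2.1.1) 1 -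
        Pi.single ((p : Plaquette d L).1, (p : Plaquette d L).2.1.2) 1 : Edge d L → K)) ≤
      Submodule.span K (Set.range fun p : Plaquette d L =>
      (Pi.single (p.1, p.2.1.1) 1 + Pi.single (p.1.shift p.2.1.1, p.2.1.2) 1 -
        Pi.single (p.1.shift p.2.1.2, p.2.1.1) 1 - Pi.single (p.1, p.2.1.2) 1 : Edge d L → K)) := by
    rw [Submodule.span_le]
    rintro _ ⟨p, rfl⟩
    exact Submodule.subset_span ⟨(p : Plaquette d L), rfl⟩
  have h3 := Submodule.finrank_mono hle
  omega

/-- **Over every field, some plaquette boundary lies outside the span of fewer than `(d−1)(L^d − 1)`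
boundaries** (`L ≥ 2`; `B` arbitrary with `#B < (d−1)(L^d − 1)`). [ours] -/
theorem exists_signedBoundary_notMem_span (K : Type*) [Field K] (hL : 2 ≤ L) (B : Finset (Plaquette d L))
    (hlt : B.card < (d - 1) * (L ^ d - 1)) :
    ∃ p' : Plaquette d L, (Pi.single (p'.1, p'.2.1.1) 1 + Pi.single (p'.1.shift p'.2.1.1, p'.2.1.2) 1 -
        Pi.single (p'.1.shift p'.2.1.2, p'.2.1.1) 1 - Pi.single (p'.1, p'.2.1.2) 1 : Edge d L → K) ∉
      Submodule.span K (Set.range fun p : B =>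
        (Pi.single ((p : Plaquette d L).1, (p : Plaquette d L).2.1.1) 1 +
        Pi.single ((p : Plaquette d L).1.shift (p : Plaquette d L).2.1.1, (p : Plaquette d L).2.1.2) 1 -
        Pi.single ((p : Plaquette d L).1.shift (p : Plaquette d L).2.1.2, (p : Plaquette d L).2.1.1) 1 -
        Pi.single ((p : Plaquette d L).1, (p : Plaquette d L).2.1.2) 1 : Edge d L → K)) := by
  classical
  by_contra hall
  push Not at hall
  set W := Submodule.span K (Set.range fun p : B =>
        (Pi.single ((p : Plaquette d L).1, (p : Plaquette d L).2.1.1) 1 +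
        Pi.single ((p : Plaquette d L).1.shift (p : Plaquette d L).2.1.1, (p : Plaquette d L).2.1.2) 1 -
        Pi.single ((p : Plaquette d L).1.shift (p : Plaquette d L).2.1.2, (p : Plaquette d L).2.1.1) 1 -
        Pi.single ((p : Plaquette d L).1, (p : Plaquette d L).2.1.2) 1 : Edge d L → K)) with hW
  have hle : Submodule.span K (Set.range fun p : Plaquette d L =>
      (Pi.single (p.1, p.2.1.1) 1 + Pi.single (p.1.shift p.2.1.1, p.2.1.2) 1 -
        Pi.single (p.1.shift p.2.1.2, p.2.1.1) 1 - Pi.single (p.1, p.2.1.2) 1 : Edge d L → K)) ≤ W := by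
    rw [Submodule.span_le]
    rintro _ ⟨p, rfl⟩
    exact hall p
  have h1 := le_finrank_span_signedBoundary (d := d) K hL
  have h2 : Module.finrank K W ≤ B.card := by
    have h := finrank_range_le_card (R := K) (fun p : B =>
      (Pi.single ((p : Plaquette d L).1, (p : Plaquette d L).2.1.1) 1 +
        Pi.single ((p : Plaquette d L).1.shift (p : Plaquette d L).2.1.1, (p : Plaquette d L).2.1.2) 1 -
        Pi.single ((p : Plaquette d L).1.shift (p : Plaquette d L).2.1.2, (p : Plaquette d L).2.1.1) 1 -
        Pi.single ((p : Plaquette d L).1, (p : Plaquette d L).2.1.2) 1 : Edge d L → K))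
    rw [Fintype.card_coe] at h
    exact h
  have h3 := Submodule.finrank_mono hle
  omega

/-! ## §2 Certificates modulo a prime -/

/-- **A certificate modulo `ℓ` for every plaquette outside the `ℤ/ℓ`-span** (`ℓ` prime): if `σ∂p'` is not a
`ℤ/ℓ`-combination of `{σ∂p : p ∈ B}`, there is `θ : links → ℤ` with `ℓ ∣ Σ_e θ_e·σ∂p(e)` for every `p ∈ B`
and `ℓ ∤ Σ_e θ_e·σ∂p'(e)` (a separating linear functional over the field `ℤ/ℓ`, coordinates lifted to `ℤ`).
[ours] -/
theorem exists_certificate_of_notMem_span_zmod (ℓ : ℕ) [Fact ℓ.Prime] (B : Finset (Plaquette d L))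
    (p' : Plaquette d L)
    (hp' : (Pi.single (p'.1, p'.2.1.1) 1 + Pi.single (p'.1.shift p'.2.1.1, p'.2.1.2) 1 -
        Pi.single (p'.1.shift p'.2.1.2, p'.2.1.1) 1 - Pi.single (p'.1, p'.2.1.2) 1 : Edge d L → ZMod ℓ) ∉
      Submodule.span (ZMod ℓ) (Set.range fun p : B =>
        (Pi.single ((p : Plaquette d L).1, (p : Plaquette d L).2.1.1) 1 +
        Pi.single ((p : Plaquette d L).1.shift (p : Plaquette d L).2.1.1, (p : Plaquette d L).2.1.2) 1 -
        Pi.single ((p : Plaquette d L).1.shift (p : Plaquette d L).2.1.2, (p : Plaquette d L).2.1.1) 1 -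
        Pi.single ((p : Plaquette d L).1, (p : Plaquette d L).2.1.2) 1 : Edge d L → ZMod ℓ))) :
    ∃ θ : Edge d L → ℤ,
      (∀ p ∈ B, (ℓ : ℤ) ∣ ∑ e, θ e * (Pi.single (p.1, p.2.1.1) 1 + Pi.single (p.1.shift p.2.1.1, p.2.1.2) 1 -
        Pi.single (p.1.shift p.2.1.2, p.2.1.1) 1 - Pi.single (p.1, p.2.1.2) 1 : Edge d L → ℤ) e) ∧
      ¬ (ℓ : ℤ) ∣ ∑ e, θ e * (Pi.single (p'.1, p'.2.1.1) 1 + Pi.single (p'.1.shift p'.2.1.1, p'.2.1.2) 1 -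
        Pi.single (p'.1.shift p'.2.1.2, p'.2.1.1) 1 - Pi.single (p'.1, p'.2.1.2) 1 : Edge d L → ℤ) e := by
  classical
  obtain ⟨f, hfne, hfW⟩ := Submodule.exists_dual_map_eq_bot_of_notMem hp' inferInstance
  have hfB : ∀ p ∈ B, f (Pi.single (p.1, p.2.1.1) 1 + Pi.single (p.1.shift p.2.1.1, p.2.1.2) 1 -
        Pi.single (p.1.shift p.2.1.2, p.2.1.1) 1 - Pi.single (p.1, p.2.1.2) 1 : Edge d L → ZMod ℓ) = 0 := by
    intro p hp
    have hmem : f (Pi.single (p.1, p.2.1.1) 1 + Pi.single (p.1.shift p.2.1.1, p.2.1.2) 1 -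
        Pi.single (p.1.shift p.2.1.2, p.2.1.1) 1 - Pi.single (p.1, p.2.1.2) 1 : Edge d L → ZMod ℓ) ∈
        (Submodule.span (ZMod ℓ) (Set.range fun p : B =>
          (Pi.single ((p : Plaquette d L).1, (p : Plaquette d L).2.1.1) 1 +
        Pi.single ((p : Plaquette d L).1.shift (p : Plaquette d L).2.1.1, (p : Plaquette d L).2.1.2) 1 -
        Pi.single ((p : Plaquette d L).1.shift (p : Plaquette d L).2.1.2, (p : Plaquette d L).2.1.1) 1 -
        Pi.single ((p : Plaquette d L).1, (p : Plaquette d L).2.1.2) 1 : Edge d L → ZMod ℓ))).map f :=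
      Submodule.mem_map_of_mem (Submodule.subset_span ⟨⟨p, hp⟩, rfl⟩)
    rw [hfW] at hmem
    exact (Submodule.mem_bot (ZMod ℓ)).1 hmem
  -- coordinates of `f`, lifted to `ℤ`
  set θq : Edge d L → ZMod ℓ := fun e => f (fun j => if e = j then 1 else 0) with hθq
  have hf_apply : ∀ v : Edge d L → ZMod ℓ, f v = ∑ e, v e * θq e := fun v => by
    rw [LinearMap.pi_apply_eq_sum_univ f v]
    rfl
  have hcast : ∀ p : Plaquette d L, (((∑ e, ((θq e).val : ℤ) * (Pi.single (p.1, p.2.1.1) 1 +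
      Pi.single (p.1.shift p.2.1.1, p.2.1.2) 1 - Pi.single (p.1.shift p.2.1.2, p.2.1.1) 1 -
      Pi.single (p.1, p.2.1.2) 1 : Edge d L → ℤ) e : ℤ)) : ZMod ℓ) =
      f (Pi.single (p.1, p.2.1.1) 1 + Pi.single (p.1.shift p.2.1.1, p.2.1.2) 1 -
        Pi.single (p.1.shift p.2.1.2, p.2.1.1) 1 - Pi.single (p.1, p.2.1.2) 1 : Edge d L → ZMod ℓ) := by
    intro p
    rw [hf_apply]
    push_cast
    refine Finset.sum_congr rfl fun e _ => ?_
    rw [ZMod.natCast_zmod_val, intCast_signedBoundary_apply_eq (R := ZMod ℓ) p e, mul_comm]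
  refine ⟨fun e => ((θq e).val : ℤ), fun p hp => ?_, ?_⟩
  · rw [← ZMod.intCast_zmod_eq_zero_iff_dvd, hcast p, hfB p hp]
  · rw [← ZMod.intCast_zmod_eq_zero_iff_dvd, hcast p']
    exact hfne

/-- **THE CERTIFICATE MODULO A PRIME.**  `L ≥ 2`; `ℓ` prime; `B` any collection of plaquettes with
`#B < (d−1)(L^d − 1)`.  There are a plaquette `p'` and `θ : links → ℤ` with `ℓ ∣ Σ_e θ_e·σ∂p(e)` for every
`p ∈ B` and `ℓ ∤ Σ_e θ_e·σ∂p'(e)`. [ours] -/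
theorem exists_certificate_mod_prime (ℓ : ℕ) [Fact ℓ.Prime] (hL : 2 ≤ L) (B : Finset (Plaquette d L))
    (hlt : B.card < (d - 1) * (L ^ d - 1)) :
    ∃ (p' : Plaquette d L) (θ : Edge d L → ℤ),
      (∀ p ∈ B, (ℓ : ℤ) ∣ ∑ e, θ e * (Pi.single (p.1, p.2.1.1) 1 + Pi.single (p.1.shift p.2.1.1, p.2.1.2) 1 -
        Pi.single (p.1.shift p.2.1.2, p.2.1.1) 1 - Pi.single (p.1, p.2.1.2) 1 : Edge d L → ℤ) e) ∧
      ¬ (ℓ : ℤ) ∣ ∑ e, θ e * (Pi.single (p'.1, p'.2.1.1) 1 + Pi.single (p'.1.shift p'.2.1.1, p'.2.1.2) 1 -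
        Pi.single (p'.1.shift p'.2.1.2, p'.2.1.1) 1 - Pi.single (p'.1, p'.2.1.2) 1 : Edge d L → ℤ) e := by
  obtain ⟨p', hp'⟩ := exists_signedBoundary_notMem_span (ZMod ℓ) hL B hlt
  obtain ⟨θ, hθ⟩ := exists_certificate_of_notMem_span_zmod ℓ B p' hp'
  exact ⟨p', θ, hθ⟩

/-! ## §3 Non-determination for every nontrivial group -/

/-- For an element `g` of prime order `ℓ`: `g^n = 1 ↔ ℓ ∣ n`. [ours] -/
theorem zpow_eq_one_iff_dvd_of_prime_order {G : Type*} [Group G] {ℓ : ℕ} [hℓ : Fact ℓ.Prime] {g : G}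
    (hgℓ : g ^ ℓ = 1) (hg1 : g ≠ 1) (n : ℤ) : g ^ n = 1 ↔ (ℓ : ℤ) ∣ n := by
  rw [← orderOf_dvd_iff_zpow_eq_one, orderOf_eq_prime hgℓ hg1]

/-- **Non-determination from an element of prime order.**  `L ≥ 2`; `#B < (d−1)(L^d − 1)`; `G` ANY group with
an element `g` of prime order `ℓ`.  Then some `p' ∉ B` is not determined by `B`: the configuration `g^θ`
(`θ` the certificate modulo `ℓ`) and the trivial configuration have the same holonomy around every `p ∈ B`
and different holonomies around `p'`. [ours] -/
theorem exists_plaquetteHolonomy_not_determined_of_prime_order (hL : 2 ≤ L) (B : Finset (Plaquette d L))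
    (hlt : B.card < (d - 1) * (L ^ d - 1)) {G : Type*} [Group G] {ℓ : ℕ} [Fact ℓ.Prime] (g : G)
    (hgℓ : g ^ ℓ = 1) (hg1 : g ≠ 1) :
    ∃ p' : Plaquette d L, p' ∉ B ∧ ∃ U V : GaugeConfig d L G,
      (∀ p ∈ B, plaquetteHolonomy U p.1 p.2.1.1 p.2.1.2 = plaquetteHolonomy V p.1 p.2.1.1 p.2.1.2) ∧
      plaquetteHolonomy U p'.1 p'.2.1.1 p'.2.1.2 ≠ plaquetteHolonomy V p'.1 p'.2.1.1 p'.2.1.2 := by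
  obtain ⟨p', θ, hB, hp'⟩ := exists_certificate_mod_prime ℓ hL B hlt
  have hone : ∀ q : Plaquette d L, plaquetteHolonomy (fun _ : Edge d L => (1 : G)) q.1 q.2.1.1 q.2.1.2 = 1 :=
    fun q => by simp [plaquetteHolonomy]
  refine ⟨p', fun hmem => hp' (hB p' hmem), fun e => g ^ θ e, fun _ => 1, fun p hp => ?_, ?_⟩
  · rw [plaquetteHolonomy_zpow_config_group, hone, zpow_eq_one_iff_dvd_of_prime_order hgℓ hg1]
    exact hB p hp
  · rw [plaquetteHolonomy_zpow_config_group, hone, Ne, zpow_eq_one_iff_dvd_of_prime_order hgℓ hg1]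
    exact hp'

/-- **Non-determination from ANY non-identity element.**  `L ≥ 2`; `#B < (d−1)(L^d − 1)`; `G` any group,
`g ≠ 1`.  If `g` has finite order `N > 1`, its power `g^{N/ℓ}` has prime order `ℓ = minFac N`
(`orderOf_pow_orderOf_div`) and the previous theorem applies; if `g` has infinite order, `g^n ≠ 1` for every
`n ≠ 0` and `HolonomyNonDeterminationAnyGroup.exists_plaquetteHolonomy_not_determined_group` applies. [ours] -/
theorem exists_plaquetteHolonomy_not_determined_of_ne_one (hL : 2 ≤ L) (B : Finset (Plaquette d L))
    (hlt : B.card < (d - 1) * (L ^ d - 1)) {G : Type*} [Group G] (g : G) (hg : g ≠ 1) :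
    ∃ p' : Plaquette d L, p' ∉ B ∧ ∃ U V : GaugeConfig d L G,
      (∀ p ∈ B, plaquetteHolonomy U p.1 p.2.1.1 p.2.1.2 = plaquetteHolonomy V p.1 p.2.1.1 p.2.1.2) ∧
      plaquetteHolonomy U p'.1 p'.2.1.1 p'.2.1.2 ≠ plaquetteHolonomy V p'.1 p'.2.1.1 p'.2.1.2 := by
  by_cases hfin : IsOfFinOrder g
  · have hN0 : orderOf g ≠ 0 := (hfin.orderOf_pos).ne'
    have hN1 : orderOf g ≠ 1 := fun h => hg (orderOf_eq_one_iff.mp h)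
    haveI : Fact (orderOf g).minFac.Prime := ⟨Nat.minFac_prime hN1⟩
    have hord : orderOf (g ^ (orderOf g / (orderOf g).minFac)) = (orderOf g).minFac :=
      orderOf_pow_orderOf_div hN0 (Nat.minFac_dvd _)
    refine exists_plaquetteHolonomy_not_determined_of_prime_order hL B hlt
      (ℓ := (orderOf g).minFac) (g ^ (orderOf g / (orderOf g).minFac)) ?_ ?_
    · have h := pow_orderOf_eq_one (g ^ (orderOf g / (orderOf g).minFac))
      rwa [hord] at h
    · intro h1
      have h := hord
      rw [h1, orderOf_one] at h
      exact (Nat.minFac_prime hN1).one_lt.ne h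
  · refine exists_plaquetteHolonomy_not_determined_group hL B hlt fun n hn => ⟨g, fun h => hfin ?_⟩
    exact isOfFinOrder_iff_zpow_eq_one.mpr ⟨n, hn, h⟩

/-- **NON-DETERMINATION BELOW `(d−1)(L^d − 1)` PLAQUETTES FOR EVERY NONTRIVIAL GAUGE GROUP.**  `L ≥ 2`; `B` any
collection of plaquettes of `(ℤ/L)^d` with `#B < (d−1)(L^d − 1)`; `G` any group with two elements (finite —
`ℤ_N`, finite subgroups of `SU(N)` — or not).  Some plaquette `p' ∉ B` carries two `G`-configurations with
the same holonomy around every `p ∈ B` and different holonomies around `p'`. [ours] -/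
theorem exists_plaquetteHolonomy_not_determined_of_nontrivial (hL : 2 ≤ L) (B : Finset (Plaquette d L))
    (hlt : B.card < (d - 1) * (L ^ d - 1)) (G : Type*) [Group G] [Nontrivial G] :
    ∃ p' : Plaquette d L, p' ∉ B ∧ ∃ U V : GaugeConfig d L G,
      (∀ p ∈ B, plaquetteHolonomy U p.1 p.2.1.1 p.2.1.2 = plaquetteHolonomy V p.1 p.2.1.1 p.2.1.2) ∧
      plaquetteHolonomy U p'.1 p'.2.1.1 p'.2.1.2 ≠ plaquetteHolonomy V p'.1 p'.2.1.1 p'.2.1.2 := by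
  obtain ⟨g, hg⟩ := exists_ne (1 : G)
  exact exists_plaquetteHolonomy_not_determined_of_ne_one hL B hlt g hg

/-- **The instance `ℤ_N` gauge theory** (`G = Multiplicative (ℤ/N)`, `N > 1`; `N`-th roots of unity written
additively): below `(d−1)(L^d − 1)` plaquettes some plaquette holonomy is not determined. [ours] -/
theorem exists_plaquetteHolonomy_not_determined_zmod (hL : 2 ≤ L) (B : Finset (Plaquette d L))
    (hlt : B.card < (d - 1) * (L ^ d - 1)) (N : ℕ) [Fact (1 < N)] :
    ∃ p' : Plaquette d L, p' ∉ B ∧ ∃ U V : GaugeConfig d L (Multiplicative (ZMod N)),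
      (∀ p ∈ B, plaquetteHolonomy U p.1 p.2.1.1 p.2.1.2 = plaquetteHolonomy V p.1 p.2.1.1 p.2.1.2) ∧
      plaquetteHolonomy U p'.1 p'.2.1.1 p'.2.1.2 ≠ plaquetteHolonomy V p'.1 p'.2.1.1 p'.2.1.2 :=
  exists_plaquetteHolonomy_not_determined_of_nontrivial hL B hlt (Multiplicative (ZMod N))

/-! ## §4 Ranked structures: determination ⇒ full, for every nontrivial group; ⇔ for commutative ones -/

/-- **For EVERY nontrivial gauge group, a ranked structure whose covered holonomies determine every plaquette
holonomy is full** (`#B = (d−1)(L^d − 1)`, i.e. optimal by `TorusRankedMorseCount.isLeast_card_compl_ranked`).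
[ours] -/
theorem covered_determine_imp_card_eq_of_nontrivial (hL : 2 ≤ L) (B : Finset (Plaquette d L))
    (t : Plaquette d L → Edge d L)
    (ht : ∀ p ∈ B, t p ∈ ({(p.1, p.2.1.1), (p.1.shift p.2.1.1, p.2.1.2),
        (p.1.shift p.2.1.2, p.2.1.1), (p.1, p.2.1.2)} : Finset (Edge d L)))
    (rank : Plaquette d L → ℕ)
    (hrank : ∀ p ∈ B, ∀ p' ∈ B, p ≠ p' → t p ∈ ({(p'.1, p'.2.1.1), (p'.1.shift p'.2.1.1, p'.2.1.2),
        (p'.1.shift p'.2.1.2, p'.2.1.1), (p'.1, p'.2.1.2)} : Finset (Edge d L)) → rank p < rank p')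
    (G : Type*) [Group G] [Nontrivial G]
    (hdet : ∀ U V : GaugeConfig d L G, (∀ p ∈ B, plaquetteHolonomy U p.1 p.2.1.1 p.2.1.2 = plaquetteHolonomy V p.1 p.2.1.1 p.2.1.2) →
      ∀ p' : Plaquette d L, plaquetteHolonomy U p'.1 p'.2.1.1 p'.2.1.2 = plaquetteHolonomy V p'.1 p'.2.1.1 p'.2.1.2) :
    B.card = (d - 1) * (L ^ d - 1) := by
  by_contra hne
  have hlt : B.card < (d - 1) * (L ^ d - 1) := lt_of_le_of_ne (card_le_of_ranked hL B t ht rank hrank) hne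
  obtain ⟨p', -, U, V, hcov, hp'⟩ := exists_plaquetteHolonomy_not_determined_of_nontrivial hL B hlt G
  exact hp' (hdet U V hcov p')

/-- **FOR EVERY NONTRIVIAL COMMUTATIVE GAUGE GROUP AND EVERY RANKED STRUCTURE: DETERMINATION ⇔ FULL.**
`L ≥ 2`; `(B, t, rank)` ranked; `G` commutative with two elements (`ℤ_N`, `U(1)`, `ℤ`, …).  The covered
holonomies determine every plaquette holonomy of every `G`-configuration iff `#B = (d−1)(L^d − 1)` (`⇐`:
`AbelianHolonomyDetermination.plaquetteHolonomy_eq_of_covered_eq`) — iff `B` is optimal. [ours] -/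
theorem covered_determine_iff_card_eq_of_comm (hL : 2 ≤ L) (B : Finset (Plaquette d L))
    (t : Plaquette d L → Edge d L)
    (ht : ∀ p ∈ B, t p ∈ ({(p.1, p.2.1.1), (p.1.shift p.2.1.1, p.2.1.2),
        (p.1.shift p.2.1.2, p.2.1.1), (p.1, p.2.1.2)} : Finset (Edge d L)))
    (rank : Plaquette d L → ℕ)
    (hrank : ∀ p ∈ B, ∀ p' ∈ B, p ≠ p' → t p ∈ ({(p'.1, p'.2.1.1), (p'.1.shift p'.2.1.1, p'.2.1.2),
        (p'.1.shift p'.2.1.2, p'.2.1.1), (p'.1, p'.2.1.2)} : Finset (Edge d L)) → rank p < rank p')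
    (G : Type*) [CommGroup G] [Nontrivial G] :
    (∀ U V : GaugeConfig d L G, (∀ p ∈ B, plaquetteHolonomy U p.1 p.2.1.1 p.2.1.2 = plaquetteHolonomy V p.1 p.2.1.1 p.2.1.2) →
        ∀ p' : Plaquette d L, plaquetteHolonomy U p'.1 p'.2.1.1 p'.2.1.2 = plaquetteHolonomy V p'.1 p'.2.1.1 p'.2.1.2) ↔
      B.card = (d - 1) * (L ^ d - 1) :=
  ⟨covered_determine_imp_card_eq_of_nontrivial hL B t ht rank hrank G,
    fun hcard U V hcov p' => plaquetteHolonomy_eq_of_covered_eq hL B t ht rank hrank hcard U V hcov p'⟩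

/-- **`ℤ_N` gauge theory, ranked structures: determination ⇔ full ⇔ optimal** (`N > 1`). [ours] -/
theorem covered_determine_iff_card_eq_zmod (hL : 2 ≤ L) (B : Finset (Plaquette d L))
    (t : Plaquette d L → Edge d L)
    (ht : ∀ p ∈ B, t p ∈ ({(p.1, p.2.1.1), (p.1.shift p.2.1.1, p.2.1.2),
        (p.1.shift p.2.1.2, p.2.1.1), (p.1, p.2.1.2)} : Finset (Edge d L)))
    (rank : Plaquette d L → ℕ)
    (hrank : ∀ p ∈ B, ∀ p' ∈ B, p ≠ p' → t p ∈ ({(p'.1, p'.2.1.1), (p'.1.shift p'.2.1.1, p'.2.1.2),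
        (p'.1.shift p'.2.1.2, p'.2.1.1), (p'.1, p'.2.1.2)} : Finset (Edge d L)) → rank p < rank p')
    (N : ℕ) [Fact (1 < N)] :
    (∀ U V : GaugeConfig d L (Multiplicative (ZMod N)),
        (∀ p ∈ B, plaquetteHolonomy U p.1 p.2.1.1 p.2.1.2 = plaquetteHolonomy V p.1 p.2.1.1 p.2.1.2) →
        ∀ p' : Plaquette d L, plaquetteHolonomy U p'.1 p'.2.1.1 p'.2.1.2 = plaquetteHolonomy V p'.1 p'.2.1.1 p'.2.1.2) ↔
      B.card = (d - 1) * (L ^ d - 1) :=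
  covered_determine_iff_card_eq_of_comm hL B t ht rank hrank (Multiplicative (ZMod N))

end Summit.Ventures.LatticeQCDFlow.Theory2.Autoregressive
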